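/-
Copyright (c) 2026 the pub-hodgecm-mathlib formalisation cell (harness21).  Prover seat hodgecm-mathlib-LA7-p01 (g3), «GO 500» half A,
organ (S1b) of A-p01 (g28)'s `stub_ESHEET` organ map (LA5-plan (g3) DEAL L5-#3), clause (m2); 2026-09-02.
-/
import Literature.AlgebraicGeometry.AbelianSchemes.SerreTwistExactPolarizationExists
import Literature.AlgebraicGeometry.AbelianSchemes.AbelianSchemeQuotientIsLambdaOfAtSq
import Literature.AlgebraicGeometry.AbelianSchemes.IsLambdaOfAtRootOfSquareAtPoint
import Literature.AlgebraicGeometry.AbelianSchemes.IsLambdaOfAtWitnessCongruence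
import Literature.AlgebraicGeometry.AbelianSchemes.DualPairFibreDimEq
import Literature.AlgebraicGeometry.AbelianSchemes.SerreTwistLevel
import Literature.AlgebraicGeometry.AbelianVarieties.AmplePicZeroTwist
import Literature.AlgebraicGeometry.AbelianSchemes.IsLambdaOfAtAlongDualIsogeny
import HarnessLib

/-!
# The EXACT Serre-twisted polarisation `λ′ : A ⊗_𝒪 𝔟 → (A ⊗_𝒪 𝔟)^` IS a polarisation: `λ̄′ = Λ(𝒪(Θ))` with `Θ` ample at every geometric point of
# characteristic `0` ([MumfordAV1970] §23 Thm. 2–3, §8; [MumfordFogartyKirwan1994] Ch. 6 §2 Def. 6.3; [RapoportSmithlingZhang2020Diagonal] (4.23))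

Topic `AlgebraicGeometry/AbelianSchemes`, namespace `Literature.AlgebraicGeometry.AbelianSchemes.AbelianSchemeOver`.  THEOREMS ONLY (no definition, no named
fact, no `instance`, no notation, no `sorry`); base `S` reduced and locally Noetherian.  Cell `hodgecm-mathlib` (D-0151), F0∕P6 «MOD», «GO 500» half A, X-LEAF
socket `stub_ESHEET` (E-pen A-p01 (g28) memo 66df4d8c), **organ (S1b) «MODULI MEMBERSHIP OF THE SERRE TWIST», clause (m2) «the exact twisted polarisation is a
`Polarization`»** (A-p01 (g28) 06:03:42Z (3): LA7-p01 keeps (m2)+(m5); LA5-plan (g3) DEAL L5-#3); `--supports stmt-HodgeConjecture-24832`, count-neutral.  HONEST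
LABEL: HC_CM is proved only modulo the 7 printed citations (2 remaining: hLiu418 = stmt-HodgeConjecture-24832, h413 = stmt-HodgeConjecture-24833) until rung 0
closes; this file discharges none of them.

## Mathematics

Setting of ★ `SerreTwistExactPolarizationExists`: `A∕S` commutative with an `𝒪`-action, a quasi-inverse presentation `(E′, P, Q, N)` (`N ≠ 0`), the cover
`ψ_P : A → B := A ⊗_𝒪 𝔟` and `ψ′ : B → A` (`ψ_P ψ′ = [N]`, `ψ′ ψ_P = [N]`), dual pairs `D`, `D_𝔟` with the unit pins, a polarisation `λ` of `A`, and the EXACT twisted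
homomorphism `λ′` (★ `IsExactTwistPol … N λ′`: `ψ_P ≫ λ′ ≫ ψ_P^∨ = λ ≫ [N]`).  THEOREM: over a base of characteristic `0`, **`λ′` is a polarisation**
([MumfordFogartyKirwan1994] Def. 6.3: `λ̄′ = Λ(𝒪(Θ))` with `Θ` AMPLE at every geometric point `s`).  Road (all ★ of the cell's (X-amp) ∕ (V)-upgrade programme):

* §1 `ψ_P ≫ λ′ = λ ≫ ψ′^∨` (cancel the quasi-invertible `ψ_P^∨`, ★ `cancel_right_of_comp_eq_pow_id`, ★ `dualIsogenyOver_serreTranslate_comp_eq_pow_id`) and the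
  graph pull-back `(ψ_P × ψ′^∨)^*𝒫_𝔟 ≅ ([N] × 1)^*𝒫` (★ (e1) `nonempty_pullbackP_dualIsogeny_iso` + `ψ_P ψ′ = [N]`);
* §2 at a geometric point: a witness `E` of `λ̄′²` — ★ (X-amp-1) `exists_isLambdaOfAt_mul_self_of_graphPullback` («`Λ(L^Δ(λ′)) = 2λ′`», [MumfordAV1970] §20 Thm. 2,
  [MumfordFogartyKirwan1994] Prop. 6.10);
* §3 `E` is AMPLE: `N•E` and `2•Θ_p` both witness `λ̄′^{2N}` (`Θ_p` an ample witness of the pull-back polarisation `λ^{pull} = λ′ ≫ [N]`, ★ `serreTwistPolPull`, ★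
  `serreTwistLamPull_eq_of_isExactTwistPol`), so `2•Θ_p − N•E` is translation invariant (★ `IsLambdaOfAt.linEquiv_pullback_translation_sub`, [MumfordAV1970] §8) and
  `E` is ample (★ `IsLambdaOfAt.isAmple_of_linEquiv_smul_add`); then the SQUARE ROOT ★ `exists_isAmple_isLambdaOfAt_of_isLambdaOfAt_sq` ([MumfordAV1970] §23
  Thm. 3, characteristic `0`) gives an ample witness of `λ̄′` itself — NO parity hypothesis on `N`;
* §4 the `Polarization` RECORD `(λ′, exists_ample)` over a base `S → Spec F`, `char F = 0`, and the one-call head from the Rosati pair.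

## References
* [MumfordAV1970] D. Mumford, *Abelian Varieties* (1970), §8 (pp. 74–77), §15 Thm. 1 (p. 143), §20 Thm. 2 (p. 188), §23 Thm. 2–3 (p. 231).
* [MumfordFogartyKirwan1994] D. Mumford, J. Fogarty, F. Kirwan, *Geometric Invariant Theory*, 3rd ed. (1994), Ch. 6 §2 Def. 6.2–6.3 (p. 120), Prop. 6.10 (p. 121).
* [RapoportSmithlingZhang2020Diagonal] M. Rapoport, B. Smithling, W. Zhang (2020), §3.2 (p. 11), §4.3 (4.23) (p. 21).
* [Conrad2004GrossZagier] B. Conrad, *Gross–Zagier revisited*, MSRI Publ. 49 (2004), §7 Thm. 7.5.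
-/

set_option autoImplicit false

-- `Scheme.Modules` ∕ `SheafOfModules` and the `Over`∕`Scheme` wrappers are not reducible (as in the ★ Serre-tensor and dual-pair files)
set_option backward.isDefEq.respectTransparency false

noncomputable section

universe u

open CategoryTheory CategoryTheory.Limits AlgebraicGeometry MonoidalCategory CartesianMonoidalCategory
open scoped MonObj

namespace Literature.AlgebraicGeometry.AbelianSchemes

namespace AbelianSchemeOver

open Literature.AlgebraicGeometry.Motives Literature.AlgebraicGeometry.AbelianVarieties Literature.AlgebraicGeometry.Modules

variable {S : Scheme.{u}} [IsReduced S] [IsLocallyNoetherian S] {A : AbelianSchemeOver S} {O : Type*} [CommRing O] (act : A.RingAction O)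
  [IsCommMonObj A.X] {m : ℕ} (E' : Matrix (Fin m) (Fin m) O) (hE' : E' * E' = E') (P : Matrix (Fin m) (Fin 1) O) (Q : Matrix (Fin 1) (Fin m) O)
  {N : ℕ} (D : A.DualPair) (Db : (serreTensor act E' hE').DualPair)
  (hD : Nonempty ((Scheme.Modules.pullback (DualPair.unitHatSlice D)).obj D.P ≅ SheafOfModules.unit _))
  (hDb : Nonempty ((Scheme.Modules.pullback (DualPair.unitHatSlice Db)).obj Db.P ≅ SheafOfModules.unit _))
  (pol : A.Polarization D)

/-! ## §1 `ψ_P ≫ λ′ = λ ≫ ψ′^∨` and the graph pull-back `(ψ_P × ψ′^∨)^*𝒫_𝔟 ≅ ([N] × 1)^*𝒫` -/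

include hD hDb in
/-- **`ψ_P ≫ λ′ = λ ≫ ψ′^∨`** for an exact `λ′`: both sides followed by `ψ_P^∨` give `λ ≫ [N]` (exactness; `ψ′^∨ ≫ ψ_P^∨ = (ψ_P ψ′)^∨ = [N]^∨ = [N]`), and
`ψ_P^∨` is right-cancellable (`ψ_P^∨ ≫ ψ′^∨ = [N]`, ★ `cancel_right_of_comp_eq_pow_id`). [cite: MumfordAV1970, §15 Thm. 1 (p. 143)]
[cite: RapoportSmithlingZhang2020Diagonal, §3.2 and (4.23)] -/
theorem serreTranslate_comp_eq_comp_dualIsogenyOver_of_isExactTwistPol (hN : N ≠ 0) (hP : E' * P = P) (hQ : Q * E' = Q)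
    (hQP : Q * P = Matrix.scalar (Fin 1) (N : O)) (hPQ : P * Q = Matrix.scalar (Fin m) (N : O) * E')
    {lam' : (serreTensor act E' hE').X ⟶ Db.hat.X} [IsMonHom lam'] (hex : IsExactTwistPol act E' hE' P D Db pol N lam') :
    haveI := isMonHom_serreTranslateInv act E' hE' Q
    serreTranslate act E' hE' P ≫ lam' = pol.lam ≫ DualPair.dualIsogenyOver (serreTranslateInv act E' hE' Q) Db D := by
  haveI := isMonHom_serreTranslate act E' hE' P
  haveI := isMonHom_serreTranslateInv act E' hE' Q
  haveI := pol.isMonHom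
  haveI : IsCommMonObj D.hat.X := D.hat.isCommMonObj_of_isReduced_base
  haveI : IsMonHom (DualPair.dualIsogenyOver (serreTranslate act E' hE' P) D Db) :=
    DualPair.isMonHom_dualIsogenyOver (serreTranslate act E' hE' P) D Db hDb hD
  haveI : IsMonHom (DualPair.dualIsogenyOver (serreTranslateInv act E' hE' Q) Db D) :=
    DualPair.isMonHom_dualIsogenyOver (serreTranslateInv act E' hE' Q) Db D hD hDb
  -- `ψ′^∨ ≫ ψ_P^∨ = [N]` on `Â`
  have hcomp : DualPair.dualIsogenyOver (serreTranslateInv act E' hE' Q) Db D ≫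
      DualPair.dualIsogenyOver (serreTranslate act E' hE' P) D Db = (𝟙 D.hat.X) ^ N :=
    dualIsogenyOver_comp_dualIsogenyOver_eq_pow_id (serreTranslateInv act E' hE' Q) (serreTranslate act E' hE' P) Db D hD
      (serreTranslate_comp_serreTranslateInv act E' hE' P Q hP hQ hQP)
  refine cancel_right_of_comp_eq_pow_id (C := A) (DualPair.dualIsogenyOver (serreTranslate act E' hE' P) D Db)
    (DualPair.dualIsogenyOver (serreTranslateInv act E' hE' Q) Db D) hN
    (dualIsogenyOver_serreTranslate_comp_eq_pow_id act E' hE' P Q hP hQ hPQ D Db hDb) _ _ ?_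
  rw [Category.assoc, (isExactTwistPol_iff act E' hE' P D Db pol N lam').mp hex, Category.assoc, hcomp, mulN_def]

omit [IsReduced S] [IsLocallyNoetherian S] in
/-- **THE GRAPH PULL-BACK `(ψ_P × ψ′^∨)^*𝒫_𝔟 ≅ ([N]_A × 1_{Â})^*𝒫`** (`ψ_P × ψ′^∨ := (ψ_P ▷ Â) ≫ (B ◁ ψ′^∨)` in `Over S`): the defining clause (e1)
`(1_B × ψ′^∨)^*𝒫_𝔟 ≅ (ψ′ × 1)^*𝒫` of the dual homomorphism (★ `nonempty_pullbackP_dualIsogeny_iso`) pulled back along `ψ_P × 1`, and `ψ_P ≫ ψ′ = [N]` — the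
`hN` input of ★ (X-amp-1) `exists_isLambdaOfAt_mul_self_of_graphPullback`. [cite: MumfordAV1970, §15 Thm. 1 (p. 143)] [cite: MumfordAV1970, §23 (p. 231)] -/
theorem nonempty_pullback_graph_serreTranslate_poincare_iso (hP : E' * P = P) (hQ : Q * E' = Q)
    (hQP : Q * P = Matrix.scalar (Fin 1) (N : O)) :
    haveI := isMonHom_serreTranslateInv act E' hE' Q
    Nonempty ((Scheme.Modules.pullback
        (((serreTranslate act E' hE' P) ▷ D.hat.X) ≫
          ((serreTensor act E' hE').X ◁ DualPair.dualIsogenyOver (serreTranslateInv act E' hE' Q) Db D)).left).obj Db.P ≅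
      (Scheme.Modules.pullback (baseChangeHom (A.mulN N) D.hat.X.hom).left).obj D.P) := by
  haveI := isMonHom_serreTranslateInv act E' hE' Q
  -- (e1): `(B ◁ ψ′^∨)^*𝒫_𝔟 = pullbackP … ≅ (ψ′_{Â})^*𝒫`
  obtain ⟨e⟩ := DualPair.nonempty_pullbackP_dualIsogeny_iso (serreTranslateInv act E' hE' Q) Db D
  have he : (Scheme.Modules.pullback ((serreTensor act E' hE').X ◁
      DualPair.dualIsogenyOver (serreTranslateInv act E' hE' Q) Db D).left).obj Db.P =
      Db.pullbackP D.hat.X.hom (DualPair.dualIsogeny (serreTranslateInv act E' hE' Q) Db D)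
        (DualPair.dualIsogeny_comp_hom (serreTranslateInv act E' hE' Q) Db D) :=
    (Db.pullbackP_eq_pullback_whiskerLeft (DualPair.dualIsogenyOver (serreTranslateInv act E' hE' Q) Db D)).symm
  -- `(ψ′_{Â}).left = (ψ′ ▷ Â).left`, `([N]_{Â}).left = ([N] ▷ Â).left`, and `(ψ_P ▷ Â) ≫ (ψ′ ▷ Â) = [N] ▷ Â`
  have hπ := A.baseChangeHom_left_eq_whiskerRight_left D (serreTensor act E' hE') (serreTranslateInv act E' hE' Q)
  have hn := A.baseChangeHom_left_eq_whiskerRight_left D A (A.mulN N)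
  have hcomp : ((serreTranslate act E' hE' P) ▷ D.hat.X).left ≫ ((serreTranslateInv act E' hE' Q) ▷ D.hat.X).left =
      (A.mulN N ▷ D.hat.X).left := by
    rw [← Over.comp_left, ← comp_whiskerRight, serreTranslate_comp_serreTranslateInv act E' hE' P Q hP hQ hQP, mulN_def]
  refine ⟨((Scheme.Modules.pullbackComp _ _).app _).symm ≪≫ (Scheme.Modules.pullback _).mapIso (eqToIso he ≪≫ e) ≪≫ ?_⟩
  exact (Scheme.Modules.pullback _).mapIso ((Scheme.Modules.pullbackCongr hπ).app _) ≪≫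
    (Scheme.Modules.pullbackComp _ _).app _ ≪≫ (Scheme.Modules.pullbackCongr (hcomp.trans hn.symm)).app _

/-! ## §2 At a geometric point: a witness `E` of `λ̄′²` (the Mumford bundle `L^Δ(λ′)`) -/

include hD hDb in
/-- **`λ̄′² = Λ(𝒪(E))` AT A GEOMETRIC POINT** (`Ω` algebraically closed, `N ≠ 0` in `Ω`): for the exact twisted homomorphism `λ′` there is a Cartier divisor `E` on the
fibre `(A ⊗ 𝔟)_s` with `IsLambdaOfAt s D_𝔟 (λ′ ^ 2) E` — ★ (X-amp-1) `exists_isLambdaOfAt_mul_self_of_graphPullback` for the cover `ψ_P` with `ψ̂ := ψ′^∨`, `π := ψ′`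
(`ψ′ ψ_P = [N]`), the graph pull-back of §1, a witness `Θ′` of `λ̄` upstairs (★ `Polarization.exists_ample`) and `ψ_P` onto on `Ω`-points (★
`exists_fibrePoints_comp_serreTranslate_eq`). [cite: MumfordAV1970, §20 Thm. 2 (p. 188) and §8 (pp. 74–75)] [cite: MumfordFogartyKirwan1994, Ch. 6 §2 Prop. 6.10 (p. 121)] -/
theorem exists_isLambdaOfAt_sq_of_isExactTwistPol (hN : N ≠ 0) (hP : E' * P = P) (hQ : Q * E' = Q)
    (hQP : Q * P = Matrix.scalar (Fin 1) (N : O)) (hPQ : P * Q = Matrix.scalar (Fin m) (N : O) * E')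
    {lam' : (serreTensor act E' hE').X ⟶ Db.hat.X} [IsMonHom lam'] (hex : IsExactTwistPol act E' hE' P D Db pol N lam')
    {Ω : Type u} [Field Ω] [IsAlgClosed Ω] (s : Spec (.of Ω) ⟶ S) (hNΩ : (N : Ω) ≠ 0) :
    ∃ E : CartierDivisor ((serreTensor act E' hE').fibre s).toAbelianVariety.X.left,
      (serreTensor act E' hE').IsLambdaOfAt s Db (lam' ^ 2) E := by
  haveI := isMonHom_serreTranslate act E' hE' P
  haveI := isMonHom_serreTranslateInv act E' hE' Q
  haveI := pol.isMonHom
  -- a witness of `λ̄` upstairs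
  obtain ⟨Θ', -, hΘ'⟩ := pol.exists_ample Ω s
  -- `ψ_P ≫ λ′ = λ ≫ ψ′^∨`, `ψ′ ≫ ψ_P = [N]`, the graph pull-back, `ψ_P` onto on `Ω`-points
  have hψl := serreTranslate_comp_eq_comp_dualIsogenyOver_of_isExactTwistPol act E' hE' P Q D Db hD hDb pol hN hP hQ hQP hPQ hex
  have hπ : serreTranslateInv act E' hE' Q ≫ serreTranslate act E' hE' P = (serreTensor act E' hE').mulN N := by
    rw [serreTranslateInv_comp_serreTranslate act E' hE' P Q hP hQ hPQ, mulN_def]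
  have hgraph := nonempty_pullback_graph_serreTranslate_poincare_iso act E' hE' P Q D Db hP hQ hQP
  have hψs := surjective_map_fibreHom_of_forall_fibrePoints (s := s) (serreTranslate act E' hE' P)
    (exists_fibrePoints_comp_serreTranslate_eq act E' hE' P Q hN hP hQ hQP hPQ s)
  -- the graph `(ι_s, λ′ ι_s) : B_s → B ×_S B̂` lies over `S`
  have hw : pullback.fst (serreTensor act E' hE').X.hom s ≫ (serreTensor act E' hE').X.hom =
      (pullback.fst (serreTensor act E' hE').X.hom s ≫ lam'.left) ≫ Db.hat.X.hom := by
    rw [Category.assoc, Over.w lam']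
  obtain ⟨E, hE, -⟩ := exists_isLambdaOfAt_mul_self_of_graphPullback s D Db (serreTranslate act E' hE' P)
    (DualPair.dualIsogenyOver (serreTranslateInv act E' hE' Q) Db D) pol.lam lam' hψl _
    (whiskerRight_comp_whiskerLeft_left_fst _ _) (whiskerRight_comp_whiskerLeft_left_snd _ _)
    hDb N (serreTranslateInv act E' hE' Q) hπ hgraph hNΩ hΘ' hψs
    (pullback.lift (pullback.fst (serreTensor act E' hE').X.hom s) (pullback.fst (serreTensor act E' hE').X.hom s ≫ lam'.left) hw)
    (pullback.lift_fst _ _ _) (pullback.lift_snd _ _ _)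
  exact ⟨E, hE⟩

/-! ## §3 `E` is ample; the square root; an AMPLE witness of `λ̄′` -/

include hD hDb in
/-- **THE EXACT TWISTED POLARISATION IS A POLARISATION AT EVERY GEOMETRIC POINT OF CHARACTERISTIC `0`**: `∃ Θ` AMPLE on `(A ⊗ 𝔟)_s` with
`λ̄′ = Λ(𝒪(Θ))` (`Ω` algebraically closed of characteristic `0`).  §2 gives `E` with `λ̄′² = Λ(𝒪(E))`; the pull-back polarisation `λ^{pull} = λ′ ≫ [N]` (★
`serreTwistPolPull`, ★ `serreTwistLamPull_eq_of_isExactTwistPol`) has an ample witness `Θ_p`, so `N•E` and `2•Θ_p` both witness `λ̄′^{2N}` (★ `IsLambdaOfAt.pow_nsmul`),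
`2•Θ_p − N•E` is translation invariant (★ `IsLambdaOfAt.linEquiv_pullback_translation_sub`) and `E` is ample (★ `IsLambdaOfAt.isAmple_of_linEquiv_smul_add`, `λ̄′^{2N}` onto
by ★ `IsLambdaOfAt.exists_comp_eq_of_isAmple_of_dim_eq`); the square root ★ `exists_isAmple_isLambdaOfAt_of_isLambdaOfAt_sq` concludes.  No parity hypothesis on `N`.
[cite: MumfordAV1970, §23 Thm. 2–3 (p. 231) and §8 (pp. 74–77)] [cite: MumfordFogartyKirwan1994, Ch. 6 §2 Definition 6.3 (p. 120)] -/
theorem exists_isAmple_isLambdaOfAt_of_isExactTwistPol (hN : N ≠ 0) (hP : E' * P = P) (hQ : Q * E' = Q)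
    (hQP : Q * P = Matrix.scalar (Fin 1) (N : O)) (hPQ : P * Q = Matrix.scalar (Fin m) (N : O) * E')
    {lam' : (serreTensor act E' hE').X ⟶ Db.hat.X} [IsMonHom lam'] (hex : IsExactTwistPol act E' hE' P D Db pol N lam')
    {Ω : Type u} [Field Ω] [IsAlgClosed Ω] [CharZero Ω] (s : Spec (.of Ω) ⟶ S) :
    ∃ Θ : CartierDivisor ((serreTensor act E' hE').fibre s).toAbelianVariety.X.left, Θ.IsAmple ∧
      (serreTensor act E' hE').IsLambdaOfAt s Db lam' Θ := by
  haveI := isMonHom_serreTranslate act E' hE' P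
  haveI := isMonHom_serreTranslateInv act E' hE' Q
  haveI := pol.isMonHom
  haveI hB : IsCommMonObj (serreTensor act E' hE').X := isCommMonObj_serreTensor act E' hE'
  haveI : IsCommMonObj Db.hat.X := Db.hat.isCommMonObj_of_isReduced_base
  have hNΩ : (N : Ω) ≠ 0 := Nat.cast_ne_zero.mpr hN
  have hdim : ((serreTensor act E' hE').fibre s).toAbelianVariety.dim = (Db.hat.fibre s).toAbelianVariety.dim :=
    DualPair.dim_fibre_eq_dim_hat_fibre Db s
  -- §2: `E` witnesses `λ̄′²`
  obtain ⟨E, hE⟩ := exists_isLambdaOfAt_sq_of_isExactTwistPol act E' hE' P Q D Db hD hDb pol hN hP hQ hQP hPQ hex s hNΩ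
  -- `Θ_p`: an ample witness of `λ^{pull} = λ′ ≫ [N] = λ′ ^ N`
  obtain ⟨Θp, hΘp_amp, hΘp⟩ := (serreTwistPolPull act E' hE' P Q D Db hD hDb pol hN hP hQ hQP hPQ).exists_ample Ω s
  have hpull : serreTwistLamPull act E' hE' Q D Db pol = lam' ^ N := by
    rw [serreTwistLamPull_eq_of_isExactTwistPol act E' hE' P Q D Db hD hDb pol hN hP hQ hQP hPQ (sq N).symm hex, mulN_def,
      MonObj.comp_pow, Category.comp_id]
  rw [serreTwistPolPull_lam, hpull] at hΘp
  haveI : IsMonHom (lam' ^ N) := Db.hat.isMonHom_pow lam' N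
  haveI : IsMonHom (lam' ^ 2) := Db.hat.isMonHom_pow lam' 2
  haveI : IsMonHom ((lam' ^ N) ^ 2) := Db.hat.isMonHom_pow (lam' ^ N) 2
  -- `2•Θ_p` and `N•E` both witness `λ̄′^{2N} = (λ′^N)^2 = (λ′^2)^N`
  have h2 : (serreTensor act E' hE').IsLambdaOfAt s Db ((lam' ^ N) ^ 2) (2 • Θp) :=
    IsLambdaOfAt.pow_nsmul _ Db (lam' ^ N) s 2 hΘp
  have hNE : (serreTensor act E' hE').IsLambdaOfAt s Db ((lam' ^ N) ^ 2) (N • E) := by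
    rw [← pow_mul, mul_comm, pow_mul]
    exact IsLambdaOfAt.pow_nsmul _ Db (lam' ^ 2) s N hE
  -- `λ̄′^{2N}` is onto on `Ω`-points (ample witness `2•Θ_p` in equal dimensions)
  have hsurj := IsLambdaOfAt.exists_comp_eq_of_isAmple_of_dim_eq _ Db s h2 (hΘp_amp.smul two_pos) hdim
  -- `2•Θ_p − N•E` is translation invariant, so `E` is ample
  have hT := IsLambdaOfAt.linEquiv_pullback_translation_sub h2 hNE
  have hlin : (2 • Θp).LinEquiv (N • E + (2 • Θp + -(N • E))) := by
    rw [← CartierDivisor.cechClass_eq_iff_linEquiv, CartierDivisor.cechClass_add, CartierDivisor.cechClass_add, cechClass_neg_eq_inv',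
      mul_left_comm, mul_inv_cancel, mul_one]
  have hEamp : E.IsAmple :=
    IsLambdaOfAt.isAmple_of_linEquiv_smul_add _ Db s ((lam' ^ N) ^ 2) h2 (hΘp_amp.smul two_pos) hsurj hT
      (Nat.pos_of_ne_zero hN) hlin
  -- the square root in characteristic `0`
  exact exists_isAmple_isLambdaOfAt_of_isLambdaOfAt_sq _ Db s hE hEamp hdim

/-! ## §4 The `Polarization` record over a base of characteristic `0`, and the one-call head from the Rosati pair -/

omit [IsReduced S] [IsLocallyNoetherian S] [IsCommMonObj A.X] in
/-- A field-valued point of a scheme over a field of characteristic `0` has characteristic `0` (private helper: the structure map gives a ring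
homomorphism `F → Ω`, which is injective). [folklore] -/
private theorem charZero_of_charZero_base {F : Type u} [Field F] [CharZero F] (f : S ⟶ Spec (.of F)) {Ω : Type u} [Field Ω]
    (s : Spec (.of Ω) ⟶ S) : CharZero Ω := by
  let φ : F →+* Ω := (Spec.preimage (s ≫ f)).hom
  refine ⟨fun a b h => Nat.cast_injective (R := F) (φ.injective ?_)⟩
  rw [map_natCast, map_natCast]
  exact h

include hD hDb in
/-- **THE `Polarization` RECORD OF THE EXACT SERRE TWIST** over a base `S → Spec F` of characteristic `0`: `∃ pol′ : (A ⊗ 𝔟).Polarization D_𝔟` with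
`pol′.lam = λ′` ([MumfordFogartyKirwan1994] Def. 6.3 — the `pol` field of the twisted moduli tuple `(A ⊗ 𝔞⁻¹, λ_𝔞, η_𝔞)` of [RapoportSmithlingZhang2020Diagonal] (4.23)).
[cite: MumfordFogartyKirwan1994, Ch. 6 §2 Definition 6.3 (p. 120)] [cite: RapoportSmithlingZhang2020Diagonal, §4.3 (4.23) (p. 21)] [cite: MumfordAV1970, §23 Thm. 2–3 (p. 231)] -/
theorem exists_polarization_lam_eq_of_isExactTwistPol {F : Type u} [Field F] [CharZero F] (f : S ⟶ Spec (.of F)) (hN : N ≠ 0)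
    (hP : E' * P = P) (hQ : Q * E' = Q) (hQP : Q * P = Matrix.scalar (Fin 1) (N : O)) (hPQ : P * Q = Matrix.scalar (Fin m) (N : O) * E')
    {lam' : (serreTensor act E' hE').X ⟶ Db.hat.X} [IsMonHom lam'] (hex : IsExactTwistPol act E' hE' P D Db pol N lam') :
    ∃ pol' : (serreTensor act E' hE').Polarization Db, pol'.lam = lam' :=
  ⟨{ lam := lam'
     isMonHom := inferInstance
     exists_ample := fun _ _ _ s =>
       haveI := charZero_of_charZero_base f s
       exists_isAmple_isLambdaOfAt_of_isExactTwistPol act E' hE' P Q D Db hD hDb pol hN hP hQ hQP hPQ hex s }, rfl⟩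

include hD hDb in
/-- **ONE CALL FROM THE ROSATI PAIR** (base `S → Spec F`, `char F = 0`; Rosati pair `1 − a ∈ 𝔞`, `b ∈ 𝔞`, `ι(a) ≫ λ = λ ≫ ι(b)^∨`): the Serre twist `A ⊗ 𝔟` carries a
POLARISATION `pol′` for `D_𝔟`, EXACT for the cover (`ψ_P ≫ pol′.lam ≫ ψ_P^∨ = λ ≫ [N]`), unique with that property among homomorphisms — ★ `exists_isExactTwistPol_of_rosatiPair`
+ `exists_polarization_lam_eq_of_isExactTwistPol` + ★ `IsExactTwistPol.eq`. [cite: MumfordAV1970, §23 Thm. 2 (p. 231)] [cite: RapoportSmithlingZhang2020Diagonal, §4.3 (4.23) (p. 21)]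
[cite: MumfordFogartyKirwan1994, Ch. 6 §2 Definition 6.3 (p. 120)] -/
theorem exists_polarization_isExactTwistPol_of_rosatiPair {F : Type u} [Field F] [CharZero F] (f : S ⟶ Spec (.of F)) (hN : N ≠ 0)
    (hP : E' * P = P) (hQ : Q * E' = Q) (hQP : Q * P = Matrix.scalar (Fin 1) (N : O)) (hPQ : P * Q = Matrix.scalar (Fin m) (N : O) * E')
    {𝔞 : Ideal O} (h𝔞 : Ideal.span (Set.range fun k => P k 0) = 𝔞) {a b : O}
    (hab : haveI := act.isMonHom b; act.i a ≫ pol.lam = pol.lam ≫ DualPair.dualIsogenyOver (act.i b) D D) (ha : 1 - a ∈ 𝔞) (hb : b ∈ 𝔞) :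
    ∃ pol' : (serreTensor act E' hE').Polarization Db,
      (haveI := isMonHom_serreTranslate act E' hE' P
       serreTranslate act E' hE' P ≫ pol'.lam ≫ DualPair.dualIsogenyOver (serreTranslate act E' hE' P) D Db = pol.lam ≫ D.hat.mulN N) ∧
      ∀ lam'' : (serreTensor act E' hE').X ⟶ Db.hat.X, IsMonHom lam'' →
        (haveI := isMonHom_serreTranslate act E' hE' P
         serreTranslate act E' hE' P ≫ lam'' ≫ DualPair.dualIsogenyOver (serreTranslate act E' hE' P) D Db = pol.lam ≫ D.hat.mulN N) →
        lam'' = pol'.lam := by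
  obtain ⟨lam', hmon, hex, -⟩ :=
    exists_isExactTwistPol_of_rosatiPair act E' hE' P Q D Db hD hDb pol hN hP hQ hQP hPQ h𝔞 hab ha hb
  haveI := hmon
  obtain ⟨pol', hpol'⟩ := exists_polarization_lam_eq_of_isExactTwistPol act E' hE' P Q D Db hD hDb pol f hN hP hQ hQP hPQ hex
  refine ⟨pol', ?_, fun lam'' hmon'' h'' => ?_⟩
  · rw [hpol']; exact (isExactTwistPol_iff act E' hE' P D Db pol N lam').mp hex
  · haveI := hmon''
    rw [hpol']
    exact IsExactTwistPol.eq act E' hE' P Q D Db hDb pol hN hP hQ hQP hPQ ((isExactTwistPol_iff act E' hE' P D Db pol N lam'').mpr h'') hex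

/-! ## §5 (ED. 2, add-only) The divisor-level Weil clause (W′_𝔞) of the exact Serre twist: `D_Q(ψ_{P,s}^*Θ′) ∼ N·D_Q(Θ)`
(LA4-p05 (g3) 06:26:08Z [L3]; one call of ★ `weilDiv_pullback_fibreHom_linEquiv_nsmul_dualIsogeny` for the cover `ψ_P`) -/

omit [IsReduced S] [IsLocallyNoetherian S] in
/-- **`(ψ_P)_s` is dominant** at every field-valued point (a fibre of the isogeny `ψ_P`; quasi-inverse `ψ′`, `N ≠ 0`) — the instance under which Cartier divisors pull
back along `(ψ_P)_s`.  A theorem, not an instance. [cite: Conrad2004GrossZagier, §7 (Thm. 7.5)] [cite: MumfordAV1970, §7 Application 3 (p. 63)] -/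
theorem isDominant_toSchemeHom_fibreHom_serreTranslate (hN : N ≠ 0) (hP : E' * P = P) (hQ : Q * E' = Q)
    (hQP : Q * P = Matrix.scalar (Fin 1) (N : O)) (hPQ : P * Q = Matrix.scalar (Fin m) (N : O) * E')
    {Ω : Type u} [Field Ω] (s : Spec (.of Ω) ⟶ S) :
    haveI := isMonHom_serreTranslate act E' hE' P
    IsDominant (AbelianVariety.Hom.toSchemeHom (fibreHom (serreTranslate act E' hE' P) s)) := by
  haveI := isMonHom_serreTranslate act E' hE' P
  haveI := isMonHom_serreTranslateInv act E' hE' Q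
  exact ⟨(isIsogeny_fibreHom_of_quasiInverse (serreTranslate act E' hE' P) (serreTranslateInv act E' hE' Q) hN
    (serreTranslate_comp_serreTranslateInv act E' hE' P Q hP hQ hQP) (serreTranslateInv_comp_serreTranslate act E' hE' P Q hP hQ hPQ)
    s).1.1.denseRange⟩

omit [IsReduced S] [IsLocallyNoetherian S] in
/-- **(W′_𝔞) THE DIVISOR-LEVEL WEIL CLAUSE OF THE EXACT SERRE TWIST**: at a field-valued point `s`, if `Θ` witnesses `λ̄ = Λ(𝒪(Θ))` on `A_s` and `Θ′` witnesses
`λ̄′ = Λ(𝒪(Θ′))` on `(A ⊗ 𝔟)_s` for the EXACT twisted homomorphism `λ′` (`ψ_P ≫ λ′ ≫ ψ_P^∨ = λ ≫ [N]`), then **`D_Q(ψ_{P,s}^*Θ′) ∼ N · D_Q(Θ)` for every `Ω`-point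
`Q` of `A_s`** (`φ_{ψ_P^*Θ′} = N·φ_Θ`, [MumfordAV1970] §23: `Λ(ψ^*L) = ψ^∨ ∘ Λ(L) ∘ ψ`) — the `hφ` binder of ★ `weilPairingLevel_map_map_eq_of_mixedLevel` (mixed-level Weil
clause `ē^{Θ′}_M(ψ_P a, ψ_P b) = ē^{Θ}_{NM}(a, b)`) for the symplectic transport along `ψ_P`; ★ `weilDiv_pullback_fibreHom_linEquiv_nsmul_dualIsogeny` at `ψ := ψ_P`, `ν := N`,
`(ψ_P)_s` dominant as a fibre of the isogeny `ψ_P` (quasi-inverse `ψ′`). [cite: MumfordAV1970, §23 (Thm. 2, p. 231)] [cite: MumfordFogartyKirwan1994, Ch. 6 §2 (6.3) (p. 121)] -/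
theorem weilDiv_pullback_serreTranslate_linEquiv_nsmul_of_isExactTwistPol (hN : N ≠ 0) (hP : E' * P = P) (hQ : Q * E' = Q)
    (hQP : Q * P = Matrix.scalar (Fin 1) (N : O)) (hPQ : P * Q = Matrix.scalar (Fin m) (N : O) * E')
    {lam' : (serreTensor act E' hE').X ⟶ Db.hat.X} [IsMonHom lam'] (hex : IsExactTwistPol act E' hE' P D Db pol N lam')
    {Ω : Type u} [Field Ω] (s : Spec (.of Ω) ⟶ S)
    {Θ : CartierDivisor (A.fibre s).toAbelianVariety.X.left} (hΘ : A.IsLambdaOfAt s D pol.lam Θ)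
    {Θ' : CartierDivisor ((serreTensor act E' hE').fibre s).toAbelianVariety.X.left} (hΘ' : (serreTensor act E' hE').IsLambdaOfAt s Db lam' Θ')
    (R : (A.fibre s).toAbelianVariety.Points Ω) :
    haveI := isMonHom_serreTranslate act E' hE' P
    haveI := isDominant_toSchemeHom_fibreHom_serreTranslate act E' hE' P Q hN hP hQ hQP hPQ s
    ((A.fibre s).toAbelianVariety.weilDiv (Θ'.pullback (AbelianVariety.Hom.toSchemeHom (fibreHom (serreTranslate act E' hE' P) s))) R).LinEquiv
      (N • (A.fibre s).toAbelianVariety.weilDiv Θ R) := by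
  haveI := isMonHom_serreTranslate act E' hE' P
  haveI := pol.isMonHom
  haveI := isDominant_toSchemeHom_fibreHom_serreTranslate act E' hE' P Q hN hP hQ hQP hPQ s
  have hb : serreTranslate act E' hE' P ≫ lam' ≫ DualPair.dualIsogenyOver (serreTranslate act E' hE' P) D Db = pol.lam ^ N := by
    rw [(isExactTwistPol_iff act E' hE' P D Db pol N lam').mp hex, mulN_def, MonObj.comp_pow, Category.comp_id]
  exact weilDiv_pullback_fibreHom_linEquiv_nsmul_dualIsogeny (serreTranslate act E' hE' P) D Db s lam' hb hΘ hΘ' R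

end AbelianSchemeOver

end Literature.AlgebraicGeometry.AbelianSchemes

end
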